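import Mathlib

/-!
# Crux `ExactCertificate` (stmt-AtomisticToContinuum-11959), line `closure-makes-nogap-exact`,
# skeleton IX (`FarSlackActive`): stub `stub_cosTaylorBounds` (F3)

Support file for the crux `ThreeConeCertificate.ExactCertificate`, skeleton IX
(`Cruxes.ExactCertificate.FarEqual.FarSlackActive`: the slack cone of an exact three-cone
certificate is active beyond every radius).  There the cosine transform of a power tail
`∫_ρ^∞ x^{−N} cos(σx) dx` is continued to an entire function of `σ` by subtracting the Taylor
polynomial `T_n` of `cos` (degree `2n`, `N = 2n + 2`) and scaling the absolutely convergent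
remainder.  This file proves the three elementary facts about the remainder
`R_n(y) = cos y − T_n(y)` over `ℂ` used there:

* `‖cos y − Σ_{k ≤ n} (−1)^k y^{2k}/(2k)!‖ ≤ ‖y‖^{2n+2} e^{‖y‖} / (2n+2)!`,
* `‖sin y − Σ_{k < n} (−1)^k y^{2k+1}/(2k+1)!‖ ≤ ‖y‖^{2n+1} e^{‖y‖} / (2n+1)!`,
* `(cos − T_n)′(y) = −(sin y − S_n(y))` with `S_n(y) = Σ_{k < n} (−1)^k y^{2k+1}/(2k+1)!`.

Proof: the power series `Complex.hasSum_cos` / `Complex.hasSum_sin`; the remainder is the tail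
sum (`hasSum_nat_add_iff'`), bounded termwise through `(2j)! N! ≤ (2j + N)!`
(`Nat.factorial_mul_factorial_dvd_factorial_add`) by `‖y‖^N/N! · ‖y‖^{2j}/(2j)!`, whose sum is
`‖y‖^N/N! · cosh ‖y‖ ≤ ‖y‖^N/N! · e^{‖y‖}` (`Real.hasSum_cosh`, `HasSum.norm_le_of_bounded`).
The derivative is `Complex.hasDerivAt_cos` minus the termwise derivative of the polynomial
(`HasDerivAt.fun_sum`, `hasDerivAt_pow`), reindexed with `Finset.sum_range_succ'`.  Pure Mathlib;
three private helpers; no named facts.  All `[folklore]`.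
-/

noncomputable section

namespace Summit.AtomisticToContinuum.Crystallization.Theorems.ThreeConeCertificateExactCertificate.FarEqual

open scoped BigOperators

/-- `a! · b! ≤ (a + b)!` (from `a! · b! ∣ (a + b)!`). [folklore] -/
private theorem factorial_mul_factorial_le (a b : ℕ) :
    a.factorial * b.factorial ≤ (a + b).factorial :=
  Nat.le_of_dvd (Nat.factorial_pos _) (Nat.factorial_mul_factorial_dvd_factorial_add a b)

/-- Norm of a term `(−1)^m y^p / p!` of the cosine/sine series: `‖y‖^p / p!`. [folklore] -/
private theorem norm_term (y : ℂ) (m p : ℕ) :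
    ‖(-1 : ℂ) ^ m * y ^ p / (p.factorial : ℂ)‖ = ‖y‖ ^ p / (p.factorial : ℝ) := by
  rw [norm_div, norm_mul, norm_pow, norm_neg, norm_one, one_pow, one_mul, norm_pow,
    Complex.norm_natCast]

/-- Generic tail bound: if `HasSum f a` over `ℕ` and the shifted terms satisfy
`‖f (j + N)‖ ≤ c · ‖r‖^{2j}/(2j)!` with `c ≥ 0`, then `‖a − Σ_{i < N} f i‖ ≤ c · e^{r}` for `r ≥ 0`
(the tail has sum `a − Σ_{i<N} f i`, dominated by `c · cosh r ≤ c · e^r`). [folklore] -/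
private theorem norm_sub_sum_le {f : ℕ → ℂ} {a : ℂ} (hf : HasSum f a) (N : ℕ) {c r : ℝ}
    (hc : 0 ≤ c) (hr : 0 ≤ r)
    (h : ∀ j, ‖f (j + N)‖ ≤ c * (r ^ (2 * j) / ((2 * j).factorial : ℝ))) :
    ‖a - ∑ i ∈ Finset.range N, f i‖ ≤ c * Real.exp r := by
  have htail : HasSum (fun j => f (j + N)) (a - ∑ i ∈ Finset.range N, f i) :=
    (hasSum_nat_add_iff' N).2 hf
  have hg : HasSum (fun j => c * (r ^ (2 * j) / ((2 * j).factorial : ℝ))) (c * Real.cosh r) :=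
    (Real.hasSum_cosh r).mul_left c
  have h1 : ‖a - ∑ i ∈ Finset.range N, f i‖ ≤ c * Real.cosh r := htail.norm_le_of_bounded hg h
  have h2 : Real.cosh r ≤ Real.exp r := by
    rw [Real.cosh_eq]
    have := Real.exp_le_exp.2 (show -r ≤ r by linarith)
    linarith
  exact h1.trans (mul_le_mul_of_nonneg_left h2 hc)

/-- Stub F3 (Taylor remainders of `cos`/`sin` on `ℂ`): `‖cos y − T_n(y)‖ ≤ ‖y‖^{2n+2}e^{‖y‖}/(2n+2)!`,
the sine analogue `‖sin y − S_n(y)‖ ≤ ‖y‖^{2n+1}e^{‖y‖}/(2n+1)!`, and `(cos − T_n)′ = −(sin − S_n)`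
(power series `Complex.hasSum_cos`/`Complex.hasSum_sin`, tail domination by
`‖y‖^N/N! · cosh ‖y‖`, termwise differentiation of the Taylor polynomial). [folklore] -/
theorem stub_cosTaylorBounds : ∀ (n : ℕ) (y : ℂ),
      ‖Complex.cos y - ∑ k ∈ Finset.range (n + 1), (-1 : ℂ) ^ k * y ^ (2 * k) / ((2 * k).factorial : ℂ)‖ ≤
          ‖y‖ ^ (2 * n + 2) * Real.exp ‖y‖ / ((2 * n + 2).factorial : ℝ) ∧
        ‖Complex.sin y - ∑ k ∈ Finset.range n, (-1 : ℂ) ^ k * y ^ (2 * k + 1) / ((2 * k + 1).factorial : ℂ)‖ ≤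
          ‖y‖ ^ (2 * n + 1) * Real.exp ‖y‖ / ((2 * n + 1).factorial : ℝ) ∧
        HasDerivAt (fun w : ℂ => Complex.cos w - ∑ k ∈ Finset.range (n + 1), (-1 : ℂ) ^ k * w ^ (2 * k) / ((2 * k).factorial : ℂ))
          (-(Complex.sin y - ∑ k ∈ Finset.range n, (-1 : ℂ) ^ k * y ^ (2 * k + 1) / ((2 * k + 1).factorial : ℂ))) y := by
  intro n y
  refine ⟨?_, ?_, ?_⟩
  · -- the cosine remainder
    have hmain : ‖Complex.cos y - ∑ k ∈ Finset.range (n + 1),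
        (-1 : ℂ) ^ k * y ^ (2 * k) / ((2 * k).factorial : ℂ)‖ ≤
        ‖y‖ ^ (2 * n + 2) / ((2 * n + 2).factorial : ℝ) * Real.exp ‖y‖ := by
      refine norm_sub_sum_le (Complex.hasSum_cos y) (n + 1) (by positivity) (norm_nonneg y) ?_
      intro j
      rw [norm_term, div_mul_div_comm, ← pow_add, show 2 * (j + (n + 1)) = 2 * n + 2 + 2 * j by ring]
      refine div_le_div_of_nonneg_left (by positivity) (by positivity) ?_
      exact_mod_cast factorial_mul_factorial_le (2 * n + 2) (2 * j)
    rwa [mul_div_right_comm]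
  · -- the sine remainder
    have hmain : ‖Complex.sin y - ∑ k ∈ Finset.range n,
        (-1 : ℂ) ^ k * y ^ (2 * k + 1) / ((2 * k + 1).factorial : ℂ)‖ ≤
        ‖y‖ ^ (2 * n + 1) / ((2 * n + 1).factorial : ℝ) * Real.exp ‖y‖ := by
      refine norm_sub_sum_le (Complex.hasSum_sin y) n (by positivity) (norm_nonneg y) ?_
      intro j
      rw [norm_term, div_mul_div_comm, ← pow_add, show 2 * (j + n) + 1 = 2 * n + 1 + 2 * j by ring]
      refine div_le_div_of_nonneg_left (by positivity) (by positivity) ?_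
      exact_mod_cast factorial_mul_factorial_le (2 * n + 1) (2 * j)
    rwa [mul_div_right_comm]
  · -- the derivative of the remainder
    have hsum : HasDerivAt
        (fun w : ℂ => ∑ k ∈ Finset.range (n + 1), (-1 : ℂ) ^ k * w ^ (2 * k) / ((2 * k).factorial : ℂ))
        (∑ k ∈ Finset.range (n + 1),
          (-1 : ℂ) ^ k * (((2 * k : ℕ) : ℂ) * y ^ (2 * k - 1)) / ((2 * k).factorial : ℂ)) y :=
      HasDerivAt.fun_sum fun k _ => ((hasDerivAt_pow (2 * k) y).const_mul ((-1 : ℂ) ^ k)).div_const _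
    have hk : ∀ k : ℕ, (-1 : ℂ) ^ (k + 1) * (((2 * (k + 1) : ℕ) : ℂ) * y ^ (2 * (k + 1) - 1)) /
        ((2 * (k + 1)).factorial : ℂ) = -((-1 : ℂ) ^ k * y ^ (2 * k + 1) / ((2 * k + 1).factorial : ℂ)) := by
      intro k
      have e1 : 2 * (k + 1) - 1 = 2 * k + 1 := by omega
      have e2 : (2 * (k + 1)).factorial = (2 * k + 2) * (2 * k + 1).factorial := by
        rw [show 2 * (k + 1) = (2 * k + 1) + 1 by ring, Nat.factorial_succ]
      have e3 : ((2 * (k + 1) : ℕ) : ℂ) = ((2 * k + 2 : ℕ) : ℂ) := by push_cast; ring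
      rw [e1, e2, e3]
      have hne : ((2 * k + 1).factorial : ℂ) ≠ 0 := Nat.cast_ne_zero.2 (Nat.factorial_ne_zero _)
      have hne2 : ((2 * k + 2 : ℕ) : ℂ) ≠ 0 := Nat.cast_ne_zero.2 (Nat.succ_ne_zero _)
      push_cast at hne hne2 ⊢
      field_simp
      ring
    have h0 : (-1 : ℂ) ^ 0 * (((2 * 0 : ℕ) : ℂ) * y ^ (2 * 0 - 1)) / ((2 * 0).factorial : ℂ) = 0 := by
      simp
    refine ((Complex.hasDerivAt_cos y).fun_sub hsum).congr_deriv ?_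
    rw [Finset.sum_range_succ', Finset.sum_congr rfl fun k _ => hk k, Finset.sum_neg_distrib, h0]
    ring
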